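import Summits.AtomisticToContinuum.FouriersLaw.Theorems.EmbeddedDrudeMourreFiniteResponseOfUnique
import Summits.AtomisticToContinuum.FouriersLaw.Theorems.EmbeddedDrudeMourreAbelThermodynamicLimitAnchoredKuboPairCorrelations
import Summits.AtomisticToContinuum.FouriersLaw.Theorems.EmbeddedDrudeMourreAbelThermodynamicLimitAnchoredKuboFlatness
import Summits.AtomisticToContinuum.FouriersLaw.Theses.StaticAbelianSqueeze
import HarnessLib

/-!
# `stub_anchoredKubo` of line `loomis-compact-horizon-witness`, part 3: the reduction
(crux `EmbeddedDrudeMourre.AbelThermodynamicLimit`, item stmt-AtomisticToContinuum-12596;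
`--supports` helper file for the registered stub S3 `stub_anchoredKubo`, closes nothing)

The registered stub S3: for `P = pinnedChain ω₂ lam β γ` (all `> 0`), under weak-NESS uniqueness,
for every steady family `μ`, response sequence `Dn` at `T > 0` and `N ≥ 2`, (1) every equilibrium
pair correlation is integrable on `(0,∞)` (PROVED, part 1 `stub_anchoredKuboPairCorr`), and
(2) `T² · Dn N = Σ_k ∫₀^∞ ⟨j_c(0) j_k(t)⟩_{N,T} dt` at the central bond `c = ⌊(N-1)/2⌋`.

Conjunct (2) is the fixed-`N` anchored Kubo formula; its analytic core is the linear response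
`δ → 0` of the steady state `μ_{N,T+δ/2,T-δ/2}`, i.e. the support items of route
`OddSectorIrreversibility`: `ResponseDensity` (stmt-AtomisticToContinuum-9144: an `L²` response
density `h`, `d/dδ μ_δ(j_i)|₀ = μ_T(j_i h)`) and `OddDensityIsCorrector` (stmt-9146: its odd part is
the Kubo corrector's, `h - h∘Θ = (u⋆ - u⋆∘Θ)/((N-1)T²)`). This file proves, sorry-free:

* `anchoredKubo_core` — at fixed `N ≥ 2`: response density + identification ⇒
  `T² D = Σ_k ∫₀^∞ ⟨j_c(0) j_k(t)⟩ dt` (`D = Σ_i μ_T(j_i h)` by uniqueness of limits;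
  `μ_T(j_i h) = μ_T(j_i u⋆)/((N-1)T²)` by oddness of `j_i` and `Θ`-invariance of `μ_T`; DC-flatness
  `Σ_i μ_T(j_i u⋆) = (N-1) μ_T(j_c u⋆)` (part 2); Fubini `μ_T(j_c u⋆) = Σ_k ∫₀^∞ ⟨j_c(0)j_k(t)⟩ dt`
  (part 1));
* `stub_anchoredKuboOfResponseDensity` (registered sub-goal) — THE STUB'S STATEMENT VERBATIM behind
  the two item hypotheses `ResponseDensity → OddDensityIsCorrector → …`;
* `anchoredKubo_core_of_summedKubo`, `anchoredKubo_of_kuboAbelIdentity` — the same from the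
  bond-summed open-chain Green–Kubo identity `(N-1)T²D = ∫₀^∞ ⟨J(0)J(t)⟩ dt`
  (`StaticAbelianSqueeze.KuboAbelIdentity`, stmt-13419 = conjunct B of `CorrectorTheory`, stmt-14071).

So `stub_anchoredKubo` follows BY NAME from either (9144 ∧ 9146) or 13419; none of the three is
proved in the tree yet (their common core: `δ`-uniform mixing / linear response of the hypoelliptic
Langevin chain), so the stub is NOT closed here.
References: Kundu–Dhar–Narayan 2009 (arXiv:0809.4543) eqs. (8)–(15); Rey-Bellet 2003 Rem. 4.4.
-/

noncomputable section

open MeasureTheory ProbabilityTheory Filter Topology Set Function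
open scoped NNReal ENNReal

namespace Summit.AtomisticToContinuum.FouriersLaw.Theorems.AbelThermodynamicLimit.LoomisCompactHorizonWitness

open Literature.MathematicalPhysics.KineticTheory.HeatConduction
open Literature.MathematicalPhysics.KineticTheory OscillatorChain
open Summit.AtomisticToContinuum.FouriersLaw.Theorems.SubdiffusiveBondHeat
open Summit.AtomisticToContinuum.FouriersLaw.Theorems.LightConeBondHeat
open Summit.AtomisticToContinuum.FouriersLaw.Theorems.OddSectorIrreversibility
open Summit.AtomisticToContinuum.FouriersLaw.Theorems.OddSectorIrreversibility.Corrector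

variable {N : ℕ}

/-! ## §4 The reduction: response density + odd-density identification ⇒ the anchored Kubo formula -/

section Reduction

variable {ω₂ lam β γ : ℝ} (hω : 0 < ω₂) (hl : 0 < lam) (hβ : 0 < β) (hγ : 0 < γ)
  {T : ℝ} (hT : 0 < T)
include hω hl hβ hγ hT

/-- **Core of the reduction (fixed `N ≥ 2`, `T > 0`).** Let `μf` be a two-temperature family of
measures at this `N` whose equal-temperature member is the Gibbs measure `μ_T`, with response
coefficient `D = lim_{δ→0,δ≠0} totalCurrent(μf (T+δ/2) (T-δ/2))/δ`. IF there are `h, u ∈ L²(μ_T)` with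
(a) `lim (μf_δ(j_i) - μ_T(j_i))/δ = ∫ j_i h dμ_T` for every bond (the response density),
(b) `∫_{(0,τ]} P_t J dt → u` `μ_T`-a.e. (the Kubo corrector of `J = Σ_k j_k`), and
(c) `h - h∘Θ = (u - u∘Θ)/((N-1)T²)` `μ_T`-a.e. (the McLennan/KDN identification of the odd part),
THEN `T² D = Σ_k ∫₀^∞ ⟨j_c(0) j_k(t)⟩_{N,T} dt` at the central bond `c = ⌊(N-1)/2⌋`:
`D = Σ_i μ_T(j_i h)` (uniqueness of limits), `μ_T(j_i h) = μ_T(j_i u)/((N-1)T²)` (`j_i` is odd,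
`μ_T` is `Θ`-invariant), `u = u⋆` a.e., DC-flatness and Fubini (§2–§3).
[cite: KunduDharNarayan2009, eqs. (8)–(15)] -/
theorem anchoredKubo_core (hN : 2 ≤ N) (μf : ℝ → ℝ → Measure (PhaseSpace N))
    (hμ0 : μf T T = (pinnedChain ω₂ lam β γ).gibbsMeasure N T) {D : ℝ}
    (hD : Tendsto (fun δ : ℝ =>
      (pinnedChain ω₂ lam β γ).totalCurrent (μf (T + δ / 2) (T - δ / 2)) / δ) (𝓝[≠] 0) (𝓝 D))
    (h u : PhaseSpace N → ℝ) (hh2 : MemLp h 2 ((pinnedChain ω₂ lam β γ).gibbsMeasure N T))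
    (hbond : ∀ i : Fin N, Tendsto (fun δ : ℝ =>
      ((∫ x, (pinnedChain ω₂ lam β γ).bondCurrent N i x ∂(μf (T + δ / 2) (T - δ / 2))) -
        ∫ x, (pinnedChain ω₂ lam β γ).bondCurrent N i x ∂(μf T T)) / δ) (𝓝[≠] 0)
      (𝓝 (∫ x, (pinnedChain ω₂ lam β γ).bondCurrent N i x * h x ∂(μf T T))))
    (hu2 : MemLp u 2 ((pinnedChain ω₂ lam β γ).gibbsMeasure N T))
    (hconv : ∀ᵐ x ∂((pinnedChain ω₂ lam β γ).gibbsMeasure N T), Tendsto (fun τ : ℝ =>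
      ∫ t in Ioc (0 : ℝ) τ, (∫ y, (∑ i : Fin N, (pinnedChain ω₂ lam β γ).bondCurrent N i y)
        ∂((pinnedChain ω₂ lam β γ).transitionKernel N T T t.toNNReal x))) atTop (𝓝 (u x)))
    (hid : ∀ᵐ x ∂((pinnedChain ω₂ lam β γ).gibbsMeasure N T),
      h x - h (x.1, -x.2) = (u x - u (x.1, -x.2)) / (((N : ℝ) - 1) * T ^ 2)) :
    T ^ 2 * D = ∑ k : Fin N, ∫ t in Ioi (0 : ℝ),
      ∫ z, (pinnedChain ω₂ lam β γ).bondCurrent N ⟨(N - 1) / 2, by omega⟩ z *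
        (∫ y, (pinnedChain ω₂ lam β γ).bondCurrent N k y
          ∂((pinnedChain ω₂ lam β γ).transitionKernel N T T t.toNNReal z))
      ∂((pinnedChain ω₂ lam β γ).gibbsMeasure N T) := by
  set P := pinnedChain ω₂ lam β γ with hP
  set μ := P.gibbsMeasure N T with hμ
  set J : PhaseSpace N → ℝ := fun y => ∑ k : Fin N, P.bondCurrent N k y with hJ
  set c₀ : ℝ := ((N : ℝ) - 1) * T ^ 2 with hc₀
  have hN0 : 0 < N := by omega
  haveI : IsProbabilityMeasure μ := pinnedChain_isProbabilityMeasure_gibbsMeasure hω hl.le hβ.le γ N hT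
  have hN1 : (0 : ℝ) < (N : ℝ) - 1 := by
    have : (2 : ℝ) ≤ N := by exact_mod_cast hN
    linarith
  have hc₀0 : c₀ ≠ 0 := by positivity
  obtain ⟨hϑ0, h2ϑ⟩ := quarter_inv_temp_admissible hT
  have hjc : ∀ k : Fin N, Continuous (P.bondCurrent N k) := pinnedChain_continuous_bondCurrent ω₂ lam β γ N
  have hjb := fun k : Fin N => LightConeBondHeat.pinnedChain_abs_bondCurrent_le_exp hω.le hl.le hβ.le γ N hϑ0 k
  have hj2 : ∀ k : Fin N, MemLp (fun x => P.bondCurrent N k x) 2 μ := fun k =>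
    memLp_two_of_abs_le_exp hω hl.le hβ.le hT γ (hjc k) h2ϑ (hjb k)
  -- Step 1: `D = Σ_i μ_T(j_i h)` by uniqueness of limits
  have h0 : ∀ i : Fin N, ∫ x, P.bondCurrent N i x ∂(μf T T) = 0 := fun i => by
    rw [hμ0]; exact pinnedChain_integral_bondCurrent_gibbsMeasure ω₂ lam β γ N T i
  have hDsum : D = ∑ i : Fin N, ∫ x, P.bondCurrent N i x * h x ∂μ := by
    have := FiniteResponse.tendsto_response_of_bond_quotients P μf T _ h0 hbond
    rw [hμ0] at this
    exact tendsto_nhds_unique hD this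
  -- Step 2: `μ_T(j_i h) = μ_T(j_i u)/c₀` (odd `j_i`, `Θ`-invariant `μ_T`)
  have hΘ := measurePreserving_reversal_gibbsMeasure P N T
  have hint : ∀ (i : Fin N) (g : PhaseSpace N → ℝ), MemLp g 2 μ →
      Integrable (fun x => P.bondCurrent N i x * g x) μ ∧
      Integrable (fun x => P.bondCurrent N i x * g (x.1, -x.2)) μ := by
    intro i g hg
    have hgΘ : MemLp (fun x => g (x.1, -x.2)) 2 μ := hg.comp_measurePreserving hΘ
    exact ⟨integrable_mul_of_integrable_sq (hjc i).aestronglyMeasurable hg.1 (hj2 i).integrable_sq hg.integrable_sq,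
      integrable_mul_of_integrable_sq (hjc i).aestronglyMeasurable hgΘ.1 (hj2 i).integrable_sq hgΘ.integrable_sq⟩
  have hpair : ∀ i : Fin N, ∫ x, P.bondCurrent N i x * h x ∂μ = (∫ x, P.bondCurrent N i x * u x ∂μ) / c₀ := by
    intro i
    have hlhs : ∫ x, P.bondCurrent N i x * (h x - h (x.1, -x.2)) ∂μ = 2 * ∫ x, P.bondCurrent N i x * h x ∂μ := by
      simp_rw [mul_sub]
      rw [integral_sub (hint i h hh2).1 (hint i h hh2).2, integral_bondCurrent_mul_comp_reversal]
      ring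
    have hrhs : ∫ x, P.bondCurrent N i x * ((u x - u (x.1, -x.2)) / c₀) ∂μ =
        2 * (∫ x, P.bondCurrent N i x * u x ∂μ) / c₀ := by
      simp_rw [mul_div_assoc', mul_sub]
      rw [integral_div, integral_sub (hint i u hu2).1 (hint i u hu2).2,
        integral_bondCurrent_mul_comp_reversal]
      ring
    have hae : ∫ x, P.bondCurrent N i x * (h x - h (x.1, -x.2)) ∂μ =
        ∫ x, P.bondCurrent N i x * ((u x - u (x.1, -x.2)) / c₀) ∂μ := by
      refine integral_congr_ae ?_
      filter_upwards [hid] with x hx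
      rw [hx]
    rw [hlhs, hrhs, mul_div_assoc] at hae
    linarith
  -- Step 3: `u = u⋆` a.e.
  obtain ⟨K, c, -, -, -, -, -, -, hptw, -⟩ := corrector_exists hω hl hβ hγ hT hN0 hϑ0 h2ϑ
    (fun s z => ∫ y, J y ∂(P.transitionKernel N T T s.toNNReal z)) rfl
    (fun z => ∫ s in Ioi (0 : ℝ), ∫ y, J y ∂(P.transitionKernel N T T s.toNNReal z)) rfl
  have hustar : ∀ᵐ x ∂μ, u x = ∫ s in Ioi (0 : ℝ), ∫ y, J y ∂(P.transitionKernel N T T s.toNNReal x) := by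
    filter_upwards [hconv] with x hx using tendsto_nhds_unique hx (hptw x)
  have hpair' : ∀ i : Fin N, ∫ x, P.bondCurrent N i x * u x ∂μ =
      ∫ x, P.bondCurrent N i x * (∫ s in Ioi (0 : ℝ), ∫ y, J y ∂(P.transitionKernel N T T s.toNNReal x)) ∂μ :=
    fun i => integral_congr_ae (by filter_upwards [hustar] with x hx; rw [hx])
  -- Step 4: flatness and Fubini
  have hc : ((⟨(N - 1) / 2, by omega⟩ : Fin N)).val + 1 < N := by
    simp only
    omega
  have hflat := stub_anchoredKuboFlatness ω₂ lam β γ hω hl hβ hγ T hT N ⟨(N - 1) / 2, by omega⟩ hc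
  have hfub := sum_integral_crossCorr_eq_integral_mul_kubo hω hl hβ hγ hN0 hT
    (hjc ⟨(N - 1) / 2, by omega⟩) (hjb ⟨(N - 1) / 2, by omega⟩)
  rw [hfub, hDsum]
  simp_rw [hpair, hpair']
  rw [← Finset.sum_div, hflat, hc₀]
  have hN1' : (N : ℝ) - 1 ≠ 0 := hN1.ne'
  have hT' : T ≠ 0 := hT.ne'
  field_simp
  rfl

omit hω hl hβ hγ hT in
/-- **Registered sub-goal `stub_anchoredKuboOfResponseDensity`:
`ResponseDensity → OddDensityIsCorrector → stub_anchoredKubo`.** The statement of the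
registered stub S3 of line `loomis-compact-horizon-witness` (crux stmt-AtomisticToContinuum-12596),
VERBATIM, behind the two support items of route `OddSectorIrreversibility`: the response-density
interface `ResponseDensity` (stmt-AtomisticToContinuum-9144) and the McLennan/KDN identification
`OddDensityIsCorrector` (stmt-AtomisticToContinuum-9146). Conjunct (1) is unconditional
(`stub_anchoredKuboPairCorr`, part 1); conjunct (2) is `anchoredKubo_core` fed with the `h` of 9144 and the `u`
of 9146 (under uniqueness the steady state at `(T, T)` is the Gibbs measure).
[cite: KunduDharNarayan2009, eqs. (8)–(15)] -/
theorem stub_anchoredKuboOfResponseDensity :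
    Summit.AtomisticToContinuum.FouriersLaw.Theses.OddSectorIrreversibility.ResponseDensity →
    Summit.AtomisticToContinuum.FouriersLaw.Theses.OddSectorIrreversibility.OddDensityIsCorrector →
    ∀ ω₂ lam β γ : ℝ, 0 < ω₂ → 0 < lam → 0 < β → 0 < γ →
      (∀ (N : ℕ) (T_L T_R : ℝ), 0 < T_L → 0 < T_R →
        ∀ μ ν : MeasureTheory.Measure
            (Literature.MathematicalPhysics.KineticTheory.HeatConduction.PhaseSpace N),
          (Literature.MathematicalPhysics.KineticTheory.HeatConduction.pinnedChain
              ω₂ lam β γ).IsSteadyState N T_L T_R μ →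
          (Literature.MathematicalPhysics.KineticTheory.HeatConduction.pinnedChain
              ω₂ lam β γ).IsSteadyState N T_L T_R ν → μ = ν) →
      ∀ T : ℝ, 0 < T →
      ∀ (μ : (N : ℕ) → ℝ → ℝ → MeasureTheory.Measure
            (Literature.MathematicalPhysics.KineticTheory.HeatConduction.PhaseSpace N))
        (Dn : ℕ → ℝ),
        (∀ (N : ℕ) (T_L T_R : ℝ), 0 < T_L → 0 < T_R →
          (Literature.MathematicalPhysics.KineticTheory.HeatConduction.pinnedChain
              ω₂ lam β γ).IsSteadyState N T_L T_R (μ N T_L T_R)) →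
        (∀ N : ℕ, Filter.Tendsto (fun δ : ℝ =>
            (Literature.MathematicalPhysics.KineticTheory.HeatConduction.pinnedChain
                ω₂ lam β γ).totalCurrent (μ N (T + δ / 2) (T - δ / 2)) / δ)
          (nhdsWithin 0 {(0 : ℝ)}ᶜ) (nhds (Dn N))) →
        ∀ (N : ℕ) (hN : 2 ≤ N),
          (∀ i k : Fin N, MeasureTheory.IntegrableOn (fun t : ℝ =>
              ∫ z, (Literature.MathematicalPhysics.KineticTheory.HeatConduction.pinnedChain
                      ω₂ lam β γ).bondCurrent N i z *
                (∫ y, (Literature.MathematicalPhysics.KineticTheory.HeatConduction.pinnedChain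
                      ω₂ lam β γ).bondCurrent N k y
                  ∂((Literature.MathematicalPhysics.KineticTheory.HeatConduction.pinnedChain
                      ω₂ lam β γ).transitionKernel N T T t.toNNReal z))
              ∂((Literature.MathematicalPhysics.KineticTheory.HeatConduction.pinnedChain
                      ω₂ lam β γ).gibbsMeasure N T)) (Set.Ioi 0)) ∧
          T ^ 2 * Dn N = ∑ k : Fin N, ∫ t in Set.Ioi (0 : ℝ),
              ∫ z, (Literature.MathematicalPhysics.KineticTheory.HeatConduction.pinnedChain
                      ω₂ lam β γ).bondCurrent N ⟨(N - 1) / 2, by omega⟩ z *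
                (∫ y, (Literature.MathematicalPhysics.KineticTheory.HeatConduction.pinnedChain
                      ω₂ lam β γ).bondCurrent N k y
                  ∂((Literature.MathematicalPhysics.KineticTheory.HeatConduction.pinnedChain
                      ω₂ lam β γ).transitionKernel N T T t.toNNReal z))
              ∂((Literature.MathematicalPhysics.KineticTheory.HeatConduction.pinnedChain
                      ω₂ lam β γ).gibbsMeasure N T) := by
  intro hRD hODC ω₂ lam β γ hω hl hβ hγ hU T hT μ Dn hμ hDn N hN
  have hN0 : 0 < N := by omega
  refine ⟨fun i k => stub_anchoredKuboPairCorr ω₂ lam β γ hω hl hβ hγ T hT N hN0 i k, ?_⟩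
  obtain ⟨h, hh⟩ := hRD ω₂ lam β γ hω hl hβ hγ hU μ hμ T hT N
  obtain ⟨u, hu2, hconv, hid⟩ := hODC ω₂ lam β γ hω hl hβ hγ hU μ hμ T hT N h hN hh
  obtain ⟨hh2, -, hbond⟩ := hh
  have hμ0 : μ N T T = (pinnedChain ω₂ lam β γ).gibbsMeasure N T :=
    FiniteResponse.steadyState_eq_gibbsMeasure_of_unique hω hl.le hβ.le hT (hU N T T hT hT)
      (hμ N T T hT hT)
  rw [hμ0] at hh2 hu2 hconv hid
  exact anchoredKubo_core hω hl hβ hγ hT hN (μ N) hμ0 (hDn N) h u hh2 hbond hu2 hconv hid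

/-! ### The same reduction from the bond-summed Kubo identity (stmt-13419 / stmt-14071 conjunct B) -/

/-- **Core, bond-summed form (fixed `N ≥ 2`, `T > 0`).** If `(N-1) T² D = ∫₀^∞ ⟨J(0) J(t)⟩_{N,T} dt`
(the Kundu–Dhar–Narayan open-chain Green–Kubo identity for the total current, the conclusion of
`StaticAbelianSqueeze.KuboAbelIdentity` at this `N`), then `T² D = Σ_k ∫₀^∞ ⟨j_c(0) j_k(t)⟩_{N,T} dt`
at the central bond: both sides are static pairings with the Kubo corrector (Fubini, §2), and the
pairing is flat in the bond (§3). [cite: KunduDharNarayan2009, eqs. (8)–(15)] -/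
theorem anchoredKubo_core_of_summedKubo (hN : 2 ≤ N) {D : ℝ}
    (hK : ((N : ℝ) - 1) * T ^ 2 * D = ∫ t in Ioi (0 : ℝ),
      ∫ z, (∑ i : Fin N, (pinnedChain ω₂ lam β γ).bondCurrent N i z) *
        (∫ y, (∑ i : Fin N, (pinnedChain ω₂ lam β γ).bondCurrent N i y)
          ∂((pinnedChain ω₂ lam β γ).transitionKernel N T T t.toNNReal z))
      ∂((pinnedChain ω₂ lam β γ).gibbsMeasure N T)) :
    T ^ 2 * D = ∑ k : Fin N, ∫ t in Ioi (0 : ℝ),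
      ∫ z, (pinnedChain ω₂ lam β γ).bondCurrent N ⟨(N - 1) / 2, by omega⟩ z *
        (∫ y, (pinnedChain ω₂ lam β γ).bondCurrent N k y
          ∂((pinnedChain ω₂ lam β γ).transitionKernel N T T t.toNNReal z))
      ∂((pinnedChain ω₂ lam β γ).gibbsMeasure N T) := by
  set P := pinnedChain ω₂ lam β γ with hP
  set μ := P.gibbsMeasure N T with hμ
  set J : PhaseSpace N → ℝ := fun y => ∑ k : Fin N, P.bondCurrent N k y with hJ
  have hN0 : 0 < N := by omega
  have hN1 : (0 : ℝ) < (N : ℝ) - 1 := by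
    have : (2 : ℝ) ≤ N := by exact_mod_cast hN
    linarith
  obtain ⟨hϑ0, h2ϑ⟩ := quarter_inv_temp_admissible hT
  have hjc : ∀ k : Fin N, Continuous (P.bondCurrent N k) := pinnedChain_continuous_bondCurrent ω₂ lam β γ N
  have hjb := fun k : Fin N => LightConeBondHeat.pinnedChain_abs_bondCurrent_le_exp hω.le hl.le hβ.le γ N hϑ0 k
  obtain ⟨M, hM, hJM⟩ := abs_totalBondCurrent_le_exp hω.le hl.le hβ.le γ N hϑ0
  have hJc : Continuous J := continuous_totalBondCurrent ω₂ lam β γ N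
  -- the corrector `u⋆` and its envelope
  obtain ⟨K, c, hK0, -, -, hwSM, hKw, -⟩ := corrector_exists hω hl hβ hγ hT hN0 hϑ0 h2ϑ
    (fun s z => ∫ y, J y ∂(P.transitionKernel N T T s.toNNReal z)) rfl
    (fun z => ∫ s in Ioi (0 : ℝ), ∫ y, J y ∂(P.transitionKernel N T T s.toNNReal z)) rfl
  have hint : ∀ i : Fin N, Integrable (fun z => P.bondCurrent N i z *
      (∫ s in Ioi (0 : ℝ), ∫ y, J y ∂(P.transitionKernel N T T s.toNNReal z))) μ := by
    intro i
    have hw := pinnedChain_integrable_abs_mul_exp hω hl.le hβ hT h2ϑ (hjc i) (hjb i)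
    refine (hw.const_mul K).mono' ((hjc i).aestronglyMeasurable.mul hwSM.aestronglyMeasurable)
      (Eventually.of_forall fun z => ?_)
    rw [Real.norm_eq_abs, abs_mul]
    calc |P.bondCurrent N i z| * |∫ s in Ioi (0 : ℝ), ∫ y, J y ∂(P.transitionKernel N T T s.toNNReal z)|
        ≤ |P.bondCurrent N i z| * (K * Real.exp (1 / (4 * T) * P.hamiltonian N z)) :=
          mul_le_mul_of_nonneg_left (hKw z) (abs_nonneg _)
      _ = K * (|P.bondCurrent N i z| * Real.exp (1 / (4 * T) * P.hamiltonian N z)) := by ring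
  -- `∫₀^∞ ⟨J J(t)⟩ = ∫ J u⋆ = Σ_i ∫ j_i u⋆ = (N-1) ∫ j_c u⋆`
  have htot := (integral_crossCorr_total_eq_integral_mul_kubo hω hl hβ hγ hN0 hT hJc hJM).2
  have hsplit : ∫ z, J z * (∫ s in Ioi (0 : ℝ), ∫ y, J y ∂(P.transitionKernel N T T s.toNNReal z)) ∂μ =
      ∑ i : Fin N, ∫ z, P.bondCurrent N i z *
        (∫ s in Ioi (0 : ℝ), ∫ y, J y ∂(P.transitionKernel N T T s.toNNReal z)) ∂μ := by
    rw [← integral_finsetSum _ fun i _ => hint i]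
    refine integral_congr_ae (Eventually.of_forall fun z => ?_)
    simp only [hJ, Finset.sum_mul]
  have hc : ((⟨(N - 1) / 2, by omega⟩ : Fin N)).val + 1 < N := by
    simp only
    omega
  have hflat := stub_anchoredKuboFlatness ω₂ lam β γ hω hl hβ hγ T hT N ⟨(N - 1) / 2, by omega⟩ hc
  have hfub := sum_integral_crossCorr_eq_integral_mul_kubo hω hl hβ hγ hN0 hT
    (hjc ⟨(N - 1) / 2, by omega⟩) (hjb ⟨(N - 1) / 2, by omega⟩)
  rw [hfub]
  rw [htot, hsplit, hflat] at hK
  have hK' : ((N : ℝ) - 1) * (T ^ 2 * D - ∫ z, P.bondCurrent N ⟨(N - 1) / 2, by omega⟩ z *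
      (∫ s in Ioi (0 : ℝ), ∫ y, J y ∂(P.transitionKernel N T T s.toNNReal z)) ∂μ) = 0 := by
    rw [mul_sub, ← mul_assoc, hK, sub_self]
  rcases mul_eq_zero.1 hK' with h | h
  · exact absurd h hN1.ne'
  · linarith

omit hω hl hβ hγ hT in
/-- **`KuboAbelIdentity → stub_anchoredKubo`.** The statement of the registered stub S3, VERBATIM,
behind the bond-summed open-chain Green–Kubo identity `(N-1)T²D = ∫₀^∞ ⟨J(0)J(t)⟩_{N,T} dt`
(`StaticAbelianSqueeze.KuboAbelIdentity`, stmt-AtomisticToContinuum-13419; = conjunct B of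
`OddSectorIrreversibility.CorrectorTheory`, stmt-AtomisticToContinuum-14071): conjunct (1) is
unconditional, conjunct (2) is `anchoredKubo_core_of_summedKubo` (DC-flatness + Fubini).
[cite: KunduDharNarayan2009, eqs. (8)–(15)] -/
theorem anchoredKubo_of_kuboAbelIdentity
    (hK : Summit.AtomisticToContinuum.FouriersLaw.Theses.StaticAbelianSqueeze.KuboAbelIdentity) :
    ∀ ω₂ lam β γ : ℝ, 0 < ω₂ → 0 < lam → 0 < β → 0 < γ →
      (∀ (N : ℕ) (T_L T_R : ℝ), 0 < T_L → 0 < T_R →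
        ∀ μ ν : MeasureTheory.Measure
            (Literature.MathematicalPhysics.KineticTheory.HeatConduction.PhaseSpace N),
          (Literature.MathematicalPhysics.KineticTheory.HeatConduction.pinnedChain
              ω₂ lam β γ).IsSteadyState N T_L T_R μ →
          (Literature.MathematicalPhysics.KineticTheory.HeatConduction.pinnedChain
              ω₂ lam β γ).IsSteadyState N T_L T_R ν → μ = ν) →
      ∀ T : ℝ, 0 < T →
      ∀ (μ : (N : ℕ) → ℝ → ℝ → MeasureTheory.Measure
            (Literature.MathematicalPhysics.KineticTheory.HeatConduction.PhaseSpace N))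
        (Dn : ℕ → ℝ),
        (∀ (N : ℕ) (T_L T_R : ℝ), 0 < T_L → 0 < T_R →
          (Literature.MathematicalPhysics.KineticTheory.HeatConduction.pinnedChain
              ω₂ lam β γ).IsSteadyState N T_L T_R (μ N T_L T_R)) →
        (∀ N : ℕ, Filter.Tendsto (fun δ : ℝ =>
            (Literature.MathematicalPhysics.KineticTheory.HeatConduction.pinnedChain
                ω₂ lam β γ).totalCurrent (μ N (T + δ / 2) (T - δ / 2)) / δ)
          (nhdsWithin 0 {(0 : ℝ)}ᶜ) (nhds (Dn N))) →
        ∀ (N : ℕ) (hN : 2 ≤ N),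
          (∀ i k : Fin N, MeasureTheory.IntegrableOn (fun t : ℝ =>
              ∫ z, (Literature.MathematicalPhysics.KineticTheory.HeatConduction.pinnedChain
                      ω₂ lam β γ).bondCurrent N i z *
                (∫ y, (Literature.MathematicalPhysics.KineticTheory.HeatConduction.pinnedChain
                      ω₂ lam β γ).bondCurrent N k y
                  ∂((Literature.MathematicalPhysics.KineticTheory.HeatConduction.pinnedChain
                      ω₂ lam β γ).transitionKernel N T T t.toNNReal z))
              ∂((Literature.MathematicalPhysics.KineticTheory.HeatConduction.pinnedChain
                      ω₂ lam β γ).gibbsMeasure N T)) (Set.Ioi 0)) ∧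
          T ^ 2 * Dn N = ∑ k : Fin N, ∫ t in Set.Ioi (0 : ℝ),
              ∫ z, (Literature.MathematicalPhysics.KineticTheory.HeatConduction.pinnedChain
                      ω₂ lam β γ).bondCurrent N ⟨(N - 1) / 2, by omega⟩ z *
                (∫ y, (Literature.MathematicalPhysics.KineticTheory.HeatConduction.pinnedChain
                      ω₂ lam β γ).bondCurrent N k y
                  ∂((Literature.MathematicalPhysics.KineticTheory.HeatConduction.pinnedChain
                      ω₂ lam β γ).transitionKernel N T T t.toNNReal z))
              ∂((Literature.MathematicalPhysics.KineticTheory.HeatConduction.pinnedChain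
                      ω₂ lam β γ).gibbsMeasure N T) := by
  intro ω₂ lam β γ hω hl hβ hγ hU T hT μ Dn hμ hDn N hN
  have hN0 : 0 < N := by omega
  refine ⟨fun i k => stub_anchoredKuboPairCorr ω₂ lam β γ hω hl hβ hγ T hT N hN0 i k, ?_⟩
  obtain ⟨-, hK2⟩ := hK ω₂ lam β γ hω hl hβ hγ hU μ hμ T hT N (Dn N) (hDn N)
  exact anchoredKubo_core_of_summedKubo hω hl hβ hγ hT hN hK2

end Reduction

end Summit.AtomisticToContinuum.FouriersLaw.Theorems.AbelThermodynamicLimit.LoomisCompactHorizonWitness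

end
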